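import Summits.QuantumFields.YangMills.Theorems.BalabanUVNodesN15KingModelAnalyticBlockTerm
import Summits.QuantumFields.YangMills.Theorems.BalabanUVNodesN15KingModelCombesThomasEngine
import Summits.QuantumFields.YangMills.Theorems.BalabanUVNodesN15KingModelComplexLinkGauge
import HarnessLib

/-!
# BalabanUVNodes ∕ N15 — THE KING-MODEL RUNG (PART Ϩ-b): THE COMBES–THOMAS CONJUGATION IS A COMPLEX DIAGONAL GAUGE TRANSFORMATION — `e^{φ}A(U,V)e^{−φ} = A(U^φ, V^φ)` with the
# TILTED link fields `U^φ(x,μ) = e^{φ(x)−φ(x+e_μ)}U(x,μ)`, `V^φ(x,μ) = e^{φ(x+e_μ)−φ(x)}V(x,μ)`, for the FULL operator (hopping term AND covariant block term: the tilt telescopes along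
# the tree contours); the tilted fields stay near the unitary base field at the price `e^{δ} − 1` per bond (bond oscillation `δ` of `φ`)
# (Track A, DAG node N15 = NE2; FAN-OUT v1.1 §N15 s3 «KING-MODEL RUNG … + what the curved case adds»; count-neutral)

HONEST FRAMING.  Count-neutral (cell `pub-ymgap`, seat `pub-ymgap-dag-n15-e` g51; `--supports stmt-QuantumFields-27247 --as helper` = K3ᴬ, KEY MAP v3).  Exact algebra on King's fine
torus (PART Ϩ-a objects; PART Ϧ-a `wtConj`; PART Ϛ-h `cxGaugeFwd∕Bwd`) plus per-bond norm bookkeeping.  WHY IT MATTERS: PART Ϧ obtained the exponential decay of `G(U)` from the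
coercivity of the CONJUGATED operator `A₀(U)_φ`, estimated by two ad-hoc «defect» computations (fine Laplacian, block term).  Once the operator lives on two-sided complex link fields,
the conjugation is literally the action of the (non-unitary, positive, diagonal) gauge transformation `g(x) = e^{φ(x)}·1 ∈ GL(n,ℂ)`: `A(U,V)_φ = A(U^φ,V^φ)`.  Hence ONE perturbation
estimate for `A(U,V)` around a unitary `U₀` (PART Ϩ-c∕Ϩ-e) delivers BOTH the complex analyticity window AND the decay in it — decay is analyticity in the imaginary (gauge) direction.
NOT Bałaban's multi-level `G_k(U)`; NOT a node discharge (N15 of record untouched); nothing continuum ∕ ℝ⁴ ∕ OS ∕ Clay.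

THE RESULTS (`K` ∕ `fine L M` the torus, `φ : T → ℝ` ANY weight, `U, V` ANY link fields, any fibre `𝕜ⁿ`):
* §1 defs **`tiltFwd K φ U`**, **`tiltBwd K φ V`**; `tiltFwd_zero`∕`tiltBwd_zero` (φ ≡ 0), ★ `tiltFwd_eq_cxGaugeFwd`∕`tiltBwd_eq_cxGaugeBwd` (`= Ϛ-h's action of g = e^{φ}·1`), `tiltBwd_conjTranspose`
  (`(U^φ)ᴴ = (Uᴴ)^{φ}` as a backward field: the tilt preserves the Hermitian slice … NOT — it maps `V = Uᴴ` to `(Uᴴ)^φ ≠ (U^φ)ᴴ = (Uᴴ)^{−φ}`; stated exactly), `wtConj_diagonal'`, ★★ **`wtConj_cxHop`**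
  (`(T_{U,V})_φ = T_{U^φ,V^φ}`), ★★ **`wtConj_cxLapF`** (`(M_{U,V})_φ = M_{U^φ,V^φ}`).
* §2 ★ `treeHol_tiltFwd` (`U^φ(Γ_{y,x}) = e^{φ(y)−φ(x)}·U(Γ_{y,x})` — the tilt TELESCOPES along the contour), ★ `treeHolRev_tiltBwd` (`V^φ(Γ_{x,y}) = e^{φ(x)−φ(y)}·V(Γ_{x,y})`),
  ★★ **`wtConj_cxGram`** (`(Q♯(V)Q(U))_φ = Q♯(V^φ)Q(U^φ)`), ★★★ **`wtConj_cxFullOp`** (`A(U,V)_φ = A(U^φ,V^φ)` — THE CONJUGATION IS A COMPLEX GAUGE TRANSFORMATION of the full operator).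
* §3 PER-BOND BOOKKEEPING under `|φ(x) − φ(x+e_μ)| ≤ δ`: `abs_exp_sub_one_le_of_abs_le` (`|s| ≤ δ ⟹ |e^s − 1| ≤ e^{δ} − 1`), `norm_exp_smul`, ★ `norm_tiltFwd_sub_le`∕`norm_tiltBwd_sub_le` (`‖U^φ_b − U₀_b‖ ≤
  e^{δ}‖U_b − U₀_b‖ + (e^{δ} − 1)‖U₀_b‖`), `tiltFwd_sub`∕`tiltBwd_sub` (linearity), ★ `norm_tiltFwd_le`∕`norm_tiltBwd_le` (`‖(δU)^φ_b‖ ≤ e^{δ}‖δU_b‖`), ★★ **`norm_tilt_zeroth_le`** (THE ZEROTH-ORDER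
  DEFECT OF A PERTURBATION TILTS GENTLY: `‖(δU)^φ_bU₀_bᴴ + U₀_b(δV)^φ_b‖ ≤ e^{δ}‖δU_bU₀_bᴴ + U₀_bδV_b‖ + 2(e^{δ}−1)‖δV_b‖` for unitary `U₀_b` — the perturbation `(δU,δV) = (U−U₀, V−U₀ᴴ)` is
  tilted, NOT the base field: the pure-gauge part `A(U₀,U₀ᴴ)_φ` stays with PART Ϧ-b's defect estimate).
PRIOR TREE ART (by name): Ϩ-a (`treeHolRev`, `cxQadj`, `cxFullOp`, `blk_cxGram_site`), Ϧ-a (`wtConj`, `wtConj_apply∕_add∕_sub∕_smul∕_mul`, `blk_wtConj`), Ϛ-a (`cxHop`, `cxLapF`), Ϛ-h (`cxGaugeFwd`,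
`cxGaugeBwd`), Ϥ-b (`treeHol`, `site_eq_parent_add_unitVec`, `BlockTree.induction`), Ϥ-c (`covQ`), Ͱ-c (`ext_of_blk`), `LatticeDiamagneticInequality` (`blk`, `placed`), Mathlib.
Dedup (rg at filing): basename 0 files; needles `tiltFwd|tiltBwd|wtConj_cxHop|wtConj_cxFullOp` 0 tree files.  presearch: «Combes–Thomas estimate as complex gauge transformation ∕ boost» is
folklore in the Schrödinger-operator literature (analytic dilation ∕ boost arguments); no Lean statement in the tree; cited as mechanism only.  Locators: [Balaban1985BackgroundPropagators]
§3.B p.399 l.37–40, p.398 l.19 (gauge transformations), (3.50)–(3.53) p.400; [Dimock2013] App. D proof of Lemma 30 (the conjugation `e_{−q}[…]e_q`); [CombesThomas1973] §II (mechanism).  0 `sorry`, 2 `def`.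
-/

noncomputable section
open scoped BigOperators ComplexConjugate Matrix.Norms.L2Operator
open Finset Matrix

namespace Summit.QuantumFields.YangMills.BalabanUVNodes.N15KingModelRung.Analytic

open Literature.MathematicalPhysics.QuantumFieldTheory.LatticeDiamagneticInequality (blk placed)
open Literature.MathematicalPhysics.QuantumFieldTheory.Balaban1983to89.B5Prop11Plancherel (Tor fine unitVec)
open Literature.MathematicalPhysics.QuantumFieldTheory.King1986.Torus (site blockOf blockOf_site blockEquiv blockEquiv_apply)
open Summit.QuantumFields.YangMills.BalabanUVNodes.N15KingModelRung.Covariant (cxLapF cxHop ext_of_blk cxGaugeFwd cxGaugeBwd l2_opNorm_of_mem_unitaryGroup_le)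
open Summit.QuantumFields.YangMills.BalabanUVNodes.N15KingModelRung.CovariantBlock (BlockTree treeHol treeHol_root treeHol_of_ne_root covQ site_eq_parent_add_unitVec)
open Summit.QuantumFields.YangMills.BalabanUVNodes.N15KingModelRung.CombesThomas (wtConj wtConj_apply wtConj_add wtConj_sub wtConj_smul blk_wtConj)

variable {d : ℕ} (K : Fin (d + 1) → ℕ) [hK : ∀ μ, NeZero (K μ)]
variable {𝕜 : Type*} [RCLike 𝕜] {n : Type*} [Fintype n] [DecidableEq n]

/-! ## §1 The tilted link fields; the hopping term -/

section Tilt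

/-- THE FORWARD TILT `U^φ(x,μ) = e^{φ(x)−φ(x+e_μ)}·U(x,μ)` of a link field by a real site weight `φ` (the action of the diagonal complex gauge `g = e^{φ}·1` on forward transporters).
[cite: Balaban1985BackgroundPropagators, p.398 l.19, §3.B p.399 l.37–40; Dimock2013, App. D, proof of Lemma 30] -/
def tiltFwd (φ : Tor K → ℝ) (U : Tor K × Fin (d + 1) → Matrix n n 𝕜) : Tor K × Fin (d + 1) → Matrix n n 𝕜 :=
  fun b => ((Real.exp (φ b.1 - φ (b.1 + unitVec K b.2)) : ℝ) : 𝕜) • U b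

/-- THE BACKWARD TILT `V^φ(x,μ) = e^{φ(x+e_μ)−φ(x)}·V(x,μ)` (the action of `g = e^{φ}·1` on backward transporters). [cite: Balaban1985BackgroundPropagators, p.398 l.19, §3.B p.399 l.37–40] -/
def tiltBwd (φ : Tor K → ℝ) (V : Tor K × Fin (d + 1) → Matrix n n 𝕜) : Tor K × Fin (d + 1) → Matrix n n 𝕜 :=
  fun b => ((Real.exp (φ (b.1 + unitVec K b.2) - φ b.1) : ℝ) : 𝕜) • V b

omit hK [Fintype n] [DecidableEq n] in
/-- No weight, no tilt. [folklore] -/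
theorem tiltFwd_zero (U : Tor K × Fin (d + 1) → Matrix n n 𝕜) : tiltFwd K (fun _ => (0 : ℝ)) U = U := by
  funext b; simp [tiltFwd]

omit hK [Fintype n] [DecidableEq n] in
/-- No weight, no tilt. [folklore] -/
theorem tiltBwd_zero (V : Tor K × Fin (d + 1) → Matrix n n 𝕜) : tiltBwd K (fun _ => (0 : ℝ)) V = V := by
  funext b; simp [tiltBwd]

omit hK in
/-- ★ **THE TILT IS PART Ϛ-h's COMPLEX GAUGE ACTION** of the positive diagonal gauge `g(x) = e^{φ(x)}·1`: `U^φ = g·U`. [cite: Balaban1985BackgroundPropagators, p.398 l.19, §3.B p.399 l.37–40] -/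
theorem tiltFwd_eq_cxGaugeFwd (φ : Tor K → ℝ) (U : Tor K × Fin (d + 1) → Matrix n n 𝕜) :
    tiltFwd K φ U = cxGaugeFwd K (fun x => ((Real.exp (φ x) : ℝ) : 𝕜) • (1 : Matrix n n 𝕜)) U := by
  funext b
  have hinv : ((((Real.exp (φ (b.1 + unitVec K b.2)) : ℝ) : 𝕜)) • (1 : Matrix n n 𝕜))⁻¹ = (((Real.exp (-φ (b.1 + unitVec K b.2)) : ℝ) : 𝕜)) • (1 : Matrix n n 𝕜) := by
    refine Matrix.inv_eq_right_inv ?_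
    rw [Matrix.smul_mul, Matrix.one_mul, smul_smul, ← RCLike.ofReal_mul, ← Real.exp_add, add_neg_cancel, Real.exp_zero, RCLike.ofReal_one, one_smul]
  simp only [tiltFwd, cxGaugeFwd]
  rw [hinv, Matrix.smul_mul, Matrix.one_mul, Matrix.mul_smul, Matrix.mul_one, smul_smul, ← RCLike.ofReal_mul, ← Real.exp_add, neg_add_eq_sub]

omit hK in
/-- ★ `V^φ = g·V` for the backward action of `g = e^{φ}·1`. [cite: Balaban1985BackgroundPropagators, p.398 l.19] -/
theorem tiltBwd_eq_cxGaugeBwd (φ : Tor K → ℝ) (V : Tor K × Fin (d + 1) → Matrix n n 𝕜) :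
    tiltBwd K φ V = cxGaugeBwd K (fun x => ((Real.exp (φ x) : ℝ) : 𝕜) • (1 : Matrix n n 𝕜)) V := by
  funext b
  have hinv : ((((Real.exp (φ b.1) : ℝ) : 𝕜)) • (1 : Matrix n n 𝕜))⁻¹ = (((Real.exp (-φ b.1) : ℝ) : 𝕜)) • (1 : Matrix n n 𝕜) := by
    refine Matrix.inv_eq_right_inv ?_
    rw [Matrix.smul_mul, Matrix.one_mul, smul_smul, ← RCLike.ofReal_mul, ← Real.exp_add, add_neg_cancel, Real.exp_zero, RCLike.ofReal_one, one_smul]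
  simp only [tiltBwd, cxGaugeBwd]
  rw [hinv, Matrix.smul_mul, Matrix.one_mul, Matrix.mul_smul, Matrix.mul_one, smul_smul, ← RCLike.ofReal_mul, ← Real.exp_add, neg_add_eq_sub]

omit hK [Fintype n] [DecidableEq n] in
/-- The adjoint of a forward tilt is the backward tilt of the adjoint field by the OPPOSITE weight: `(U^φ)ᴴ = (Uᴴ)^{−φ}` — the tilt leaves the Hermitian slice `V = Uᴴ` (as it must:
`A(U,Uᴴ)_φ` is not Hermitian). [folklore] -/
theorem tiltFwd_conjTranspose (φ : Tor K → ℝ) (U : Tor K × Fin (d + 1) → Matrix n n 𝕜) (b : Tor K × Fin (d + 1)) :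
    (tiltFwd K φ U b)ᴴ = tiltBwd K (fun x => -φ x) (fun bd => (U bd)ᴴ) b := by
  simp only [tiltFwd, tiltBwd, conjTranspose_smul, RCLike.star_def, RCLike.conj_ofReal]
  congr 2; ring

omit hK [Fintype n] in
/-- Diagonal matrices are fixed by the conjugation. [folklore] -/
theorem wtConj_diagonal' (φ : Tor K → ℝ) (f : Tor K × n → 𝕜) : wtConj K φ (diagonal f) = diagonal f := by
  ext p q
  by_cases h : p = q
  · subst h; rw [wtConj_apply, sub_self, Real.exp_zero, RCLike.ofReal_one, one_mul]
  · rw [wtConj_apply, diagonal_apply_ne _ h, mul_zero]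

omit hK [Fintype n] [DecidableEq n] in
/-- The conjugate of a placed block: `(E_{xy}(A))_φ = E_{xy}(e^{φ(x)−φ(y)}A)`. [folklore] -/
theorem wtConj_placed (φ : Tor K → ℝ) (x y : Tor K) (A : Matrix n n 𝕜) :
    wtConj K φ (placed x y A) = placed x y ((((Real.exp (φ x - φ y)) : ℝ) : 𝕜) • A) := by
  ext p q
  simp only [wtConj_apply, placed, Matrix.of_apply, Matrix.smul_apply, smul_eq_mul]
  by_cases h : x = p.1 ∧ y = q.1
  · rw [if_pos h, if_pos h, h.1, h.2]
  · rw [if_neg h, if_neg h, mul_zero]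

omit hK [Fintype n] [DecidableEq n] in
/-- The conjugation over a finite sum. [folklore] -/
theorem wtConj_sum {ι : Type*} (s : Finset ι) (φ : Tor K → ℝ) (F : ι → Matrix (Tor K × n) (Tor K × n) 𝕜) :
    wtConj K φ (∑ i ∈ s, F i) = ∑ i ∈ s, wtConj K φ (F i) := by
  classical
  induction s using Finset.induction_on with
  | empty => ext p q; simp [wtConj_apply]
  | insert a s ha ih => rw [Finset.sum_insert ha, Finset.sum_insert ha, wtConj_add, ih]

omit [Fintype n] [DecidableEq n] in
/-- ★★ **THE CONJUGATED HOPPING MATRIX IS THE HOPPING MATRIX OF THE TILTED FIELDS**: `(T_{U,V})_φ = T_{U^φ,V^φ}`. [cite: Balaban1985BackgroundPropagators, p.398 l.19, (3.50) p.400; Dimock2013, App. D, proof of Lemma 30] -/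
theorem wtConj_cxHop (φ : Tor K → ℝ) (c : ℝ) (U V : Tor K × Fin (d + 1) → Matrix n n 𝕜) :
    wtConj K φ (cxHop K c U V) = cxHop K c (tiltFwd K φ U) (tiltBwd K φ V) := by
  unfold cxHop
  rw [wtConj_sum]
  refine Finset.sum_congr rfl fun b _ => ?_
  rw [wtConj_smul, wtConj_add, wtConj_placed, wtConj_placed]
  rfl

omit [Fintype n] in
/-- ★★ **THE CONJUGATED FINE OPERATOR IS THE FINE OPERATOR OF THE TILTED FIELDS**: `(M_{U,V})_φ = M_{U^φ,V^φ}` (the site weights are diagonal). [cite: Balaban1985BackgroundPropagators, §3.B p.399 l.37–40; Dimock2013, App. D, proof of Lemma 30] -/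
theorem wtConj_cxLapF (φ : Tor K → ℝ) (c m2 : ℝ) (U V : Tor K × Fin (d + 1) → Matrix n n 𝕜) :
    wtConj K φ (cxLapF K c m2 U V) = cxLapF K c m2 (tiltFwd K φ U) (tiltBwd K φ V) := by
  unfold cxLapF
  rw [wtConj_sub, wtConj_diagonal', wtConj_cxHop]

end Tilt

/-! ## §2 The tilt telescopes along the tree contours: the block term -/

section Block

variable {L : ℕ} [NeZero L] (T : BlockTree d L) (M : Fin (d + 1) → ℕ) [hM : ∀ μ, NeZero (M μ)]

omit hM in
/-- ★ **THE FORWARD TILT TELESCOPES ALONG THE CONTOUR**: `U^φ(Γ_{y,x}) = e^{φ(y)−φ(x)}·U(Γ_{y,x})` (`y` = the corner `site b 0`, `x = site b j`): the inner weights of consecutive bonds cancel.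
[cite: Balaban1985BackgroundPropagators, (3.19) p.393, (3.32) p.395 (gauge covariance of the averaging)] -/
theorem treeHol_tiltFwd (φ : Tor (fine L M) → ℝ) (U : Tor (fine L M) × Fin (d + 1) → Matrix n n 𝕜) (b : Tor M) :
    ∀ j, treeHol M T (tiltFwd (fine L M) φ U) b j = (((Real.exp (φ (site L M b T.root) - φ (site L M b j))) : ℝ) : 𝕜) • treeHol M T U b j := by
  refine T.induction (P := fun j => treeHol M T (tiltFwd (fine L M) φ U) b j = (((Real.exp (φ (site L M b T.root) - φ (site L M b j))) : ℝ) : 𝕜) • treeHol M T U b j) ?_ fun j hj ih => ?_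
  · rw [treeHol_root, treeHol_root, sub_self, Real.exp_zero, RCLike.ofReal_one, one_smul]
  · rw [treeHol_of_ne_root T M _ b hj, treeHol_of_ne_root T M U b hj, ih]
    simp only [tiltFwd]
    rw [← site_eq_parent_add_unitVec T M b hj, Matrix.smul_mul, Matrix.mul_smul, smul_smul, ← RCLike.ofReal_mul, ← Real.exp_add]
    congr 3; ring

omit hM in
/-- ★ **THE BACKWARD TILT TELESCOPES**: `V^φ(Γ_{x,y}) = e^{φ(x)−φ(y)}·V(Γ_{x,y})`. [cite: Balaban1985BackgroundPropagators, (3.19) p.393, (3.32) p.395] -/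
theorem treeHolRev_tiltBwd (φ : Tor (fine L M) → ℝ) (V : Tor (fine L M) × Fin (d + 1) → Matrix n n 𝕜) (b : Tor M) :
    ∀ j, treeHolRev M T (tiltBwd (fine L M) φ V) b j = (((Real.exp (φ (site L M b j) - φ (site L M b T.root))) : ℝ) : 𝕜) • treeHolRev M T V b j := by
  refine T.induction (P := fun j => treeHolRev M T (tiltBwd (fine L M) φ V) b j = (((Real.exp (φ (site L M b j) - φ (site L M b T.root))) : ℝ) : 𝕜) • treeHolRev M T V b j) ?_
    fun j hj ih => ?_
  · rw [treeHolRev_root, treeHolRev_root, sub_self, Real.exp_zero, RCLike.ofReal_one, one_smul]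
  · rw [treeHolRev_of_ne_root T M _ b hj, treeHolRev_of_ne_root T M V b hj, ih]
    simp only [tiltBwd]
    rw [← site_eq_parent_add_unitVec T M b hj, Matrix.smul_mul, Matrix.mul_smul, smul_smul, ← RCLike.ofReal_mul, ← Real.exp_add]
    congr 3; ring

/-- ★★ **THE CONJUGATED BLOCK TERM IS THE BLOCK TERM OF THE TILTED FIELDS**: `(Q♯(V)Q(U))_φ = Q♯(V^φ)Q(U^φ)` (block by block: `e^{φ(x)−φ(x′)} = e^{φ(x)−φ(y)}·e^{φ(y)−φ(x′)}` through the corner `y`).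
[cite: Balaban1985BackgroundPropagators, (3.19) p.393, (3.24) p.394, (3.32) p.395] -/
theorem wtConj_cxGram (φ : Tor (fine L M) → ℝ) (U V : Tor (fine L M) × Fin (d + 1) → Matrix n n 𝕜) :
    wtConj (fine L M) φ (cxQadj T M V * covQ T M U) = cxQadj T M (tiltBwd (fine L M) φ V) * covQ T M (tiltFwd (fine L M) φ U) := by
  refine ext_of_blk (fine L M) fun x x' => ?_
  obtain ⟨⟨β, j⟩, rfl⟩ := (blockEquiv L M).surjective x
  obtain ⟨⟨β', j'⟩, rfl⟩ := (blockEquiv L M).surjective x'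
  simp only [blockEquiv_apply]
  rw [blk_wtConj, blk_cxGram_site, blk_cxGram_site]
  by_cases h : β = β'
  · subst h
    have hexp : ((L : ℝ) ^ (d + 1))⁻¹ ^ 2 * Real.exp (φ (site L M β j) - φ (site L M β T.root)) * Real.exp (φ (site L M β T.root) - φ (site L M β j'))
        = Real.exp (φ (site L M β j) - φ (site L M β j')) * ((L : ℝ) ^ (d + 1))⁻¹ ^ 2 := by
      rw [mul_assoc, ← Real.exp_add, mul_comm]; congr 2; ring
    rw [if_pos rfl, if_pos rfl, treeHol_tiltFwd, treeHolRev_tiltBwd, Matrix.smul_mul, Matrix.mul_smul, smul_smul, smul_smul, smul_smul, ← RCLike.ofReal_mul, ← RCLike.ofReal_mul,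
      ← RCLike.ofReal_mul, hexp]
  · rw [if_neg h, if_neg h, smul_zero]

/-- ★★★ **THE COMBES–THOMAS CONJUGATION IS A COMPLEX DIAGONAL GAUGE TRANSFORMATION OF THE FULL OPERATOR**: `e^{φ}A(U,V)e^{−φ} = A(U^φ,V^φ)` for every weight `φ`, every tree contour system,
all fields, every `a, c, m²`. [cite: Balaban1985BackgroundPropagators, §3.B p.399 l.37–40, p.398 l.19; Dimock2013, App. D, proof of Lemma 30] -/
theorem wtConj_cxFullOp (φ : Tor (fine L M) → ℝ) (a c m2 : ℝ) (U V : Tor (fine L M) × Fin (d + 1) → Matrix n n 𝕜) :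
    wtConj (fine L M) φ (cxFullOp T M a c m2 U V) = cxFullOp T M a c m2 (tiltFwd (fine L M) φ U) (tiltBwd (fine L M) φ V) := by
  rw [cxFullOp, cxFullOp, wtConj_add, wtConj_smul, wtConj_cxLapF, wtConj_cxGram]

end Block

/-! ## §3 Per-bond bookkeeping: the tilted fields stay near the unitary base field -/

section Bookkeeping

omit hK in
/-- `|s| ≤ δ ⟹ |e^s − 1| ≤ e^{δ} − 1` (monotonicity and `e^{δ} + e^{−δ} ≥ 2`). [folklore] -/
theorem abs_exp_sub_one_le_of_abs_le {s δ : ℝ} (h : |s| ≤ δ) : |Real.exp s - 1| ≤ Real.exp δ - 1 := by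
  have hs1 : s ≤ δ := (le_abs_self s).trans h
  have hs2 : -δ ≤ s := by have := neg_abs_le s; linarith
  have e1 : Real.exp s ≤ Real.exp δ := Real.exp_le_exp.2 hs1
  have e2 : Real.exp (-δ) ≤ Real.exp s := Real.exp_le_exp.2 hs2
  have e3 : 2 ≤ Real.exp δ + Real.exp (-δ) := by
    have hc := Real.one_le_cosh δ
    rw [Real.cosh_eq] at hc
    linarith
  rw [abs_le]
  constructor <;> linarith

/-- The norm of a real scalar multiple of a unitary-or-smaller matrix block: `‖(e^s)·A‖ = e^s‖A‖`. [folklore] -/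
theorem norm_exp_smul (s : ℝ) (A : Matrix n n 𝕜) : ‖(((Real.exp s : ℝ)) : 𝕜) • A‖ = Real.exp s * ‖A‖ := by
  rw [norm_smul, RCLike.norm_ofReal, abs_of_pos (Real.exp_pos s)]

omit hK in
/-- ★ **THE FORWARD TILT STAYS NEAR THE BASE FIELD**: if `|φ(x) − φ(x+e_μ)| ≤ δ` then `‖U^φ_b − U₀_b‖ ≤ e^{δ}·‖U_b − U₀_b‖ + (e^{δ} − 1)·‖U₀_b‖`
(`U^φ − U₀ = e^{−θ}(U − U₀) + (e^{−θ} − 1)U₀`). [cite: Balaban1985BackgroundPropagators, (3.50) p.400 (shape)] -/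
theorem norm_tiltFwd_sub_le {φ : Tor K → ℝ} {δ : ℝ} (hφ : ∀ x μ, |φ x - φ (x + unitVec K μ)| ≤ δ) (U U₀ : Tor K × Fin (d + 1) → Matrix n n 𝕜) (b : Tor K × Fin (d + 1)) :
    ‖tiltFwd K φ U b - U₀ b‖ ≤ Real.exp δ * ‖U b - U₀ b‖ + (Real.exp δ - 1) * ‖U₀ b‖ := by
  set s : ℝ := φ b.1 - φ (b.1 + unitVec K b.2) with hs
  have hsδ : |s| ≤ δ := hφ b.1 b.2
  have hexp : Real.exp s ≤ Real.exp δ := Real.exp_le_exp.2 ((le_abs_self s).trans hsδ)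
  have hexp1 : |Real.exp s - 1| ≤ Real.exp δ - 1 := abs_exp_sub_one_le_of_abs_le hsδ
  have hsplit : tiltFwd K φ U b - U₀ b = (((Real.exp s : ℝ)) : 𝕜) • (U b - U₀ b) + ((((Real.exp s - 1 : ℝ)) : 𝕜)) • U₀ b := by
    simp only [tiltFwd, ← hs, smul_sub, RCLike.ofReal_sub, RCLike.ofReal_one, sub_smul, one_smul]; abel
  rw [hsplit]
  refine (norm_add_le _ _).trans (add_le_add ?_ ?_)
  · rw [norm_exp_smul]; exact mul_le_mul_of_nonneg_right hexp (norm_nonneg _)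
  · rw [norm_smul, RCLike.norm_ofReal]; exact mul_le_mul_of_nonneg_right hexp1 (norm_nonneg _)

omit hK in
/-- ★ THE BACKWARD TILT STAYS NEAR THE BASE FIELD: `‖V^φ_b − W₀_b‖ ≤ e^{δ}·‖V_b − W₀_b‖ + (e^{δ} − 1)·‖W₀_b‖`. [cite: Balaban1985BackgroundPropagators, (3.50) p.400 (shape)] -/
theorem norm_tiltBwd_sub_le {φ : Tor K → ℝ} {δ : ℝ} (hφ : ∀ x μ, |φ x - φ (x + unitVec K μ)| ≤ δ) (V W₀ : Tor K × Fin (d + 1) → Matrix n n 𝕜) (b : Tor K × Fin (d + 1)) :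
    ‖tiltBwd K φ V b - W₀ b‖ ≤ Real.exp δ * ‖V b - W₀ b‖ + (Real.exp δ - 1) * ‖W₀ b‖ := by
  set s : ℝ := φ (b.1 + unitVec K b.2) - φ b.1 with hs
  have hsδ : |s| ≤ δ := by rw [hs, abs_sub_comm]; exact hφ b.1 b.2
  have hexp : Real.exp s ≤ Real.exp δ := Real.exp_le_exp.2 ((le_abs_self s).trans hsδ)
  have hexp1 : |Real.exp s - 1| ≤ Real.exp δ - 1 := abs_exp_sub_one_le_of_abs_le hsδ
  have hsplit : tiltBwd K φ V b - W₀ b = (((Real.exp s : ℝ)) : 𝕜) • (V b - W₀ b) + ((((Real.exp s - 1 : ℝ)) : 𝕜)) • W₀ b := by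
    simp only [tiltBwd, ← hs, smul_sub, RCLike.ofReal_sub, RCLike.ofReal_one, sub_smul, one_smul]; abel
  rw [hsplit]
  refine (norm_add_le _ _).trans (add_le_add ?_ ?_)
  · rw [norm_exp_smul]; exact mul_le_mul_of_nonneg_right hexp (norm_nonneg _)
  · rw [norm_smul, RCLike.norm_ofReal]; exact mul_le_mul_of_nonneg_right hexp1 (norm_nonneg _)

omit hK [Fintype n] [DecidableEq n] in
/-- The tilts are linear in the field: `(U − U₀)^φ = U^φ − U₀^φ`. [folklore] -/
theorem tiltFwd_sub (φ : Tor K → ℝ) (U U₀ : Tor K × Fin (d + 1) → Matrix n n 𝕜) : tiltFwd K φ (U - U₀) = tiltFwd K φ U - tiltFwd K φ U₀ := by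
  funext b; simp only [tiltFwd, Pi.sub_apply, smul_sub]

omit hK [Fintype n] [DecidableEq n] in
/-- `(V − V₀)^φ = V^φ − V₀^φ`. [folklore] -/
theorem tiltBwd_sub (φ : Tor K → ℝ) (V V₀ : Tor K × Fin (d + 1) → Matrix n n 𝕜) : tiltBwd K φ (V - V₀) = tiltBwd K φ V - tiltBwd K φ V₀ := by
  funext b; simp only [tiltBwd, Pi.sub_apply, smul_sub]

omit hK in
/-- ★ `‖(δU)^φ_b‖ ≤ e^{δ}‖δU_b‖` under `|φ(x) − φ(x+e_μ)| ≤ δ`. [folklore] -/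
theorem norm_tiltFwd_le {φ : Tor K → ℝ} {δ : ℝ} (hφ : ∀ x μ, |φ x - φ (x + unitVec K μ)| ≤ δ) (W : Tor K × Fin (d + 1) → Matrix n n 𝕜) (b : Tor K × Fin (d + 1)) :
    ‖tiltFwd K φ W b‖ ≤ Real.exp δ * ‖W b‖ := by
  simp only [tiltFwd]
  rw [norm_exp_smul]
  exact mul_le_mul_of_nonneg_right (Real.exp_le_exp.2 ((le_abs_self _).trans (hφ b.1 b.2))) (norm_nonneg _)

omit hK in
/-- ★ `‖(δV)^φ_b‖ ≤ e^{δ}‖δV_b‖`. [folklore] -/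
theorem norm_tiltBwd_le {φ : Tor K → ℝ} {δ : ℝ} (hφ : ∀ x μ, |φ x - φ (x + unitVec K μ)| ≤ δ) (W : Tor K × Fin (d + 1) → Matrix n n 𝕜) (b : Tor K × Fin (d + 1)) :
    ‖tiltBwd K φ W b‖ ≤ Real.exp δ * ‖W b‖ := by
  simp only [tiltBwd]
  rw [norm_exp_smul]
  refine mul_le_mul_of_nonneg_right (Real.exp_le_exp.2 ((le_abs_self _).trans ?_)) (norm_nonneg _)
  rw [abs_sub_comm]; exact hφ b.1 b.2

omit hK in
/-- ★★ **THE ZEROTH-ORDER DEFECT OF A PERTURBATION TILTS GENTLY**: for unitary `U₀_b`, `|φ(x) − φ(x+e_μ)| ≤ δ`, and perturbation fields `δU, δV`,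
`‖(δU)^φ_b·U₀_bᴴ + U₀_b·(δV)^φ_b‖ ≤ e^{δ}·‖δU_b·U₀_bᴴ + U₀_b·δV_b‖ + 2(e^{δ} − 1)·‖δV_b‖`
(`e^{−θ}A + e^{θ}B = e^{−θ}(A + B) + (e^{θ} − e^{−θ})B`, `|e^{θ} − e^{−θ}| ≤ 2(e^{δ} − 1)`) — a second-order defect (`O(ε²)` on print's slice `V = U⁻¹`) stays `O(e^{δ}ε² + (e^{δ}−1)ε)`.
[cite: Balaban1985BackgroundPropagators, (3.48)–(3.50) pp.398–400 (shape)] -/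
theorem norm_tilt_zeroth_le {φ : Tor K → ℝ} {δ : ℝ} (hφ : ∀ x μ, |φ x - φ (x + unitVec K μ)| ≤ δ) {U₀ : Tor K × Fin (d + 1) → Matrix n n 𝕜} (hU₀ : ∀ b, U₀ b ∈ Matrix.unitaryGroup n 𝕜)
    (δU δV : Tor K × Fin (d + 1) → Matrix n n 𝕜) (b : Tor K × Fin (d + 1)) :
    ‖tiltFwd K φ δU b * (U₀ b)ᴴ + U₀ b * tiltBwd K φ δV b‖
      ≤ Real.exp δ * ‖δU b * (U₀ b)ᴴ + U₀ b * δV b‖ + 2 * (Real.exp δ - 1) * ‖δV b‖ := by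
  set s : ℝ := φ b.1 - φ (b.1 + unitVec K b.2) with hs
  have hsδ : |s| ≤ δ := hφ b.1 b.2
  have hU1 : ‖U₀ b‖ ≤ 1 := l2_opNorm_of_mem_unitaryGroup_le (hU₀ b)
  set A := δU b * (U₀ b)ᴴ with hA
  set B := U₀ b * δV b with hB
  have hs' : φ (b.1 + unitVec K b.2) - φ b.1 = -s := by rw [hs]; ring
  have hcomb : tiltFwd K φ δU b * (U₀ b)ᴴ + U₀ b * tiltBwd K φ δV b
      = (((Real.exp s : ℝ)) : 𝕜) • (A + B) + ((((Real.exp (-s) - Real.exp s : ℝ)) : 𝕜)) • B := by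
    simp only [tiltFwd, tiltBwd, ← hs, hs', Matrix.smul_mul, Matrix.mul_smul, ← hA, ← hB, RCLike.ofReal_sub, sub_smul, smul_add]
    abel
  have hexp : Real.exp s ≤ Real.exp δ := Real.exp_le_exp.2 ((le_abs_self s).trans hsδ)
  have h1 : ‖(((Real.exp s : ℝ)) : 𝕜) • (A + B)‖ ≤ Real.exp δ * ‖A + B‖ := by
    rw [norm_exp_smul]; exact mul_le_mul_of_nonneg_right hexp (norm_nonneg _)
  have hdiff : |Real.exp (-s) - Real.exp s| ≤ 2 * (Real.exp δ - 1) := by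
    have e1 := abs_exp_sub_one_le_of_abs_le hsδ
    have e2 : |Real.exp (-s) - 1| ≤ Real.exp δ - 1 := abs_exp_sub_one_le_of_abs_le (by rw [abs_neg]; exact hsδ)
    calc |Real.exp (-s) - Real.exp s| = |(Real.exp (-s) - 1) - (Real.exp s - 1)| := by ring_nf
      _ ≤ |Real.exp (-s) - 1| + |Real.exp s - 1| := abs_sub _ _
      _ ≤ 2 * (Real.exp δ - 1) := by linarith
  have h2 : ‖((((Real.exp (-s) - Real.exp s : ℝ)) : 𝕜)) • B‖ ≤ 2 * (Real.exp δ - 1) * ‖δV b‖ := by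
    rw [norm_smul, RCLike.norm_ofReal]
    refine mul_le_mul hdiff ?_ (norm_nonneg _) (by linarith [abs_nonneg (Real.exp (-s) - Real.exp s)])
    calc ‖B‖ ≤ ‖U₀ b‖ * ‖δV b‖ := norm_mul_le _ _
      _ ≤ 1 * ‖δV b‖ := mul_le_mul_of_nonneg_right hU1 (norm_nonneg _)
      _ = ‖δV b‖ := one_mul _
  rw [hcomb]
  exact (norm_add_le _ _).trans (add_le_add h1 h2)

end Bookkeeping

end Summit.QuantumFields.YangMills.BalabanUVNodes.N15KingModelRung.Analytic

end
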